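import Summits.QuantumFields.QCD.Theorems.SpectralDefectExtinctionWindowExtinctionChessboardDefs
import Summits.QuantumFields.QCD.Theorems.SpectralDefectExtinctionAFBookkeeping

/-!
# Crux `WindowExtinction` (item stmt-QuantumFields-8964), line `chessboard-cold-cells`:
# the eventual-in-`k` arithmetic of `stub_deep` (S5)

Helper file for the registered stub `stub_deep` (pure real analysis, no physics):

* `deep_tendsto_afBeta_mul_self`, `deep_tendsto_beta_mul_a`, `deep_tendsto_beta_atTop`: along an asymptotically
  scaling scheme `β_k a_k → 0`, and `β_k → +∞` when `N_f ≤ 16` (`b₀ > 0`);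
* `deep_eventually_const_mul_beta_le_L`: `C β_k ≤ L_k` eventually (`a_k L_k → ∞`), so blocks of side
  `≍ √β_k` fit in the scheme's tori;
* `deep_blockSide_sq_le`, `deep_three_mul_le_blockSide_sq`, `deep_le_blockSide`: the block side
  `n(β) = ⌊√(25β/2)⌋` has `n² ≤ 25β/2`, `n² ≥ 3β` (`β ≥ 1`), and `n ≥ c` once `(c+1)² ≤ 25β/2`;
* `deep_entropy_bound`: for `n ≥ 100`,
  `24 (n+1)⁴ · C((n+1)⁴, ⌈n⁴/128⌉) · e^{−7⌈n⁴/128⌉} ≤ e^{−n⁴/1024}` — the binomial entropy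
  `C(N, r) ≤ (eN/r)^r ≤ (256 e)^r = e^{(1 + 8 log 2) r}`, `1 + 8 log 2 < 6.55 < 7`.
-/

noncomputable section

namespace Summit.QuantumFields.QCD.Cruxes.WindowExtinction.ChessboardColdCells

open Filter Topology
open Literature.MathematicalPhysics.QuantumFieldTheory
open Summit.QuantumFields.QCD.Theorems (betaCoeff₀_pos_of_le_sixteen)

/-! ### Asymptotic scaling: `β_k a_k → 0`, `β_k → ∞` -/

/-- `a_k log(1/a_k) → 0` along a positive null sequence. -/
theorem deep_tendsto_mul_log_one_div {a : ℕ → ℝ} (ha : ∀ k, 0 < a k) (ha0 : Tendsto a atTop (𝓝 0)) :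
    Tendsto (fun k => a k * Real.log (1 / a k)) atTop (𝓝 0) := by
  have h1 : Tendsto (fun k => 1 / a k) atTop atTop := by
    have h : Tendsto a atTop (𝓝[>] 0) :=
      tendsto_nhdsWithin_iff.mpr ⟨ha0, Eventually.of_forall fun k => ha k⟩
    refine h.inv_tendsto_nhdsGT_zero.congr' (Eventually.of_forall fun k => ?_)
    simp [one_div]
  have h2 := Real.isLittleO_log_id_atTop.tendsto_div_nhds_zero.comp h1
  refine h2.congr' (Eventually.of_forall fun k => ?_)
  have hak : a k ≠ 0 := (ha k).ne'
  simp only [Function.comp_apply, id]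
  field_simp

/-- The large logarithm `ℓ_k = log(1/(a_k² Λ²)) → +∞`. -/
theorem deep_tendsto_largeLog_atTop {a : ℕ → ℝ} (ha : ∀ k, 0 < a k) (ha0 : Tendsto a atTop (𝓝 0))
    {Λ : ℝ} (hΛ : 0 < Λ) : Tendsto (fun k => Real.log (1 / (a k ^ 2 * Λ ^ 2))) atTop atTop := by
  have h1 : Tendsto (fun k => a k ^ 2 * Λ ^ 2) atTop (𝓝[>] 0) := by
    refine tendsto_nhdsWithin_iff.mpr ⟨?_, Eventually.of_forall fun k => ?_⟩
    · simpa using (ha0.pow 2).mul_const (Λ ^ 2)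
    · have := ha k
      show 0 < a k ^ 2 * Λ ^ 2
      positivity
  have h2 := Real.tendsto_log_atTop.comp h1.inv_tendsto_nhdsGT_zero
  refine h2.congr' (Eventually.of_forall fun k => ?_)
  simp [one_div]

/-- `ℓ_k a_k → 0` for the large logarithm `ℓ_k = log(1/(a_k² Λ²)) = 2 log(1/a_k) − 2 log Λ`. -/
theorem deep_tendsto_largeLog_mul {a : ℕ → ℝ} (ha : ∀ k, 0 < a k) (ha0 : Tendsto a atTop (𝓝 0))
    {Λ : ℝ} (hΛ : 0 < Λ) : Tendsto (fun k => Real.log (1 / (a k ^ 2 * Λ ^ 2)) * a k) atTop (𝓝 0) := by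
  have hid : ∀ k, Real.log (1 / (a k ^ 2 * Λ ^ 2)) * a k =
      2 * (a k * Real.log (1 / a k)) - 2 * Real.log Λ * a k := by
    intro k
    have hak : a k ≠ 0 := (ha k).ne'
    rw [one_div, Real.log_inv, Real.log_mul (pow_ne_zero 2 hak) (pow_ne_zero 2 hΛ.ne'), Real.log_pow,
      Real.log_pow, one_div, Real.log_inv]
    push_cast
    ring
  simp_rw [hid]
  have h1 := (deep_tendsto_mul_log_one_div ha ha0).const_mul 2
  have h2 := ha0.const_mul (2 * Real.log Λ)
  simpa using h1.sub h2

/-- `afBeta N_f Λ a_k · a_k → 0`: the two-loop profile grows only logarithmically in `1/a`. -/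
theorem deep_tendsto_afBeta_mul_self (Nf : ℕ) {a : ℕ → ℝ} (ha : ∀ k, 0 < a k) (ha0 : Tendsto a atTop (𝓝 0))
    {Λ : ℝ} (hΛ : 0 < Λ) : Tendsto (fun k => afBeta Nf Λ (a k) * a k) atTop (𝓝 0) := by
  set ℓ : ℕ → ℝ := fun k => Real.log (1 / (a k ^ 2 * Λ ^ 2)) with hℓ
  have hℓa : Tendsto (fun k => ℓ k * a k) atTop (𝓝 0) := deep_tendsto_largeLog_mul ha ha0 hΛ
  have hℓtop : Tendsto ℓ atTop atTop := deep_tendsto_largeLog_atTop ha ha0 hΛ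
  -- `log ℓ_k · a_k → 0` by `0 ≤ log ℓ ≤ ℓ` eventually
  have hlog : Tendsto (fun k => Real.log (ℓ k) * a k) atTop (𝓝 0) := by
    refine squeeze_zero_norm' ?_ hℓa
    filter_upwards [hℓtop.eventually_ge_atTop 1] with k hk
    rw [Real.norm_eq_abs, abs_mul, abs_of_pos (ha k)]
    refine mul_le_mul_of_nonneg_right ?_ (ha k).le
    rw [abs_of_nonneg (Real.log_nonneg hk)]
    exact (Real.log_le_sub_one_of_pos (by linarith)).trans (by linarith)
  have h := (hℓa.const_mul (2 * betaCoeff₀ Nf)).add (hlog.const_mul (2 * (betaCoeff₁ Nf / betaCoeff₀ Nf)))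
  rw [mul_zero, mul_zero, add_zero] at h
  refine h.congr' (Eventually.of_forall fun k => ?_)
  simp only [afBeta, hℓ]
  ring

variable {Nf : ℕ}

/-- **`β_k a_k → 0`** along an asymptotically scaling scheme. -/
theorem deep_tendsto_beta_mul_a (sch : QCDScheme Nf) (hAS : sch.HasAsymptoticScaling) :
    Tendsto (fun k => sch.β k * sch.a k) atTop (𝓝 0) := by
  obtain ⟨Λ, hΛ, hε⟩ := hAS
  have h1 : Tendsto (fun k => (sch.β k - afBeta Nf Λ (sch.a k)) * sch.a k) atTop (𝓝 0) := by
    simpa using hε.mul sch.tendsto_a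
  have h2 := deep_tendsto_afBeta_mul_self Nf sch.a_pos sch.tendsto_a hΛ
  have h := h1.add h2
  rw [add_zero] at h
  refine h.congr' (Eventually.of_forall fun k => ?_)
  ring

/-- **`β_k → +∞`** along an asymptotically scaling scheme with `N_f ≤ 16` (`b₀ > 0`). -/
theorem deep_tendsto_beta_atTop (hNf : Nf ≤ 16) (sch : QCDScheme Nf) (hAS : sch.HasAsymptoticScaling) :
    Tendsto sch.β atTop atTop := by
  obtain ⟨Λ, hΛ, hε⟩ := hAS
  have hb₀ : 0 < betaCoeff₀ Nf := betaCoeff₀_pos_of_le_sixteen hNf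
  set ℓ : ℕ → ℝ := fun k => Real.log (1 / (sch.a k ^ 2 * Λ ^ 2)) with hℓ
  have hℓtop : Tendsto ℓ atTop atTop := deep_tendsto_largeLog_atTop sch.a_pos sch.tendsto_a hΛ
  -- `afBeta = ℓ (2b₀ + 2(b₁/b₀) log ℓ / ℓ) → ∞`
  have hratio : Tendsto (fun k => 2 * betaCoeff₀ Nf + 2 * (betaCoeff₁ Nf / betaCoeff₀ Nf) *
      (Real.log (ℓ k) / ℓ k)) atTop (𝓝 (2 * betaCoeff₀ Nf)) := by
    have h1 : Tendsto (fun k => Real.log (ℓ k) / ℓ k) atTop (𝓝 0) :=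
      Real.isLittleO_log_id_atTop.tendsto_div_nhds_zero.comp hℓtop
    simpa using (h1.const_mul (2 * (betaCoeff₁ Nf / betaCoeff₀ Nf))).const_add (2 * betaCoeff₀ Nf)
  have haf : Tendsto (fun k => afBeta Nf Λ (sch.a k)) atTop atTop := by
    have h := hℓtop.atTop_mul_pos (by linarith) hratio
    refine h.congr' ?_
    filter_upwards [hℓtop.eventually_gt_atTop 0] with k hk
    simp only [afBeta, hℓ] at hk ⊢
    field_simp
  have h := haf.atTop_add hε
  refine h.congr' (Eventually.of_forall fun k => ?_)
  ring

/-- **Blocks fit in the scheme's tori**: `C β_k ≤ L_k` eventually, for every `C > 0`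
(`β_k a_k → 0` while `a_k L_k → ∞`). -/
theorem deep_eventually_const_mul_beta_le_L (reg : QCDRegularisation Nf)
    (hAS : (reg.scheme 0 0 0).HasAsymptoticScaling) {C : ℝ} (hC : 0 < C) :
    ∀ᶠ k in atTop, C * reg.β k ≤ reg.L k := by
  have h1 : Tendsto (fun k => reg.β k * reg.a k) atTop (𝓝 0) := deep_tendsto_beta_mul_a _ hAS
  have h2 : ∀ᶠ k in atTop, |reg.β k * reg.a k| < 1 / C := by
    have := h1.abs
    rw [abs_zero] at this
    exact this.eventually (gt_mem_nhds (by positivity))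
  filter_upwards [h2, reg.tendsto_L.eventually_ge_atTop 1] with k hk hL
  have ha := reg.a_pos k
  have hβa : C * |reg.β k| * reg.a k ≤ 1 := by
    rw [abs_mul, abs_of_pos ha] at hk
    have := (lt_div_iff₀ hC).1 hk
    nlinarith
  -- `C β ≤ C|β| = (C|β| a)/a ≤ 1/a ≤ L`
  have h3 : C * reg.β k * reg.a k ≤ reg.a k * reg.L k := by
    calc C * reg.β k * reg.a k ≤ C * |reg.β k| * reg.a k := by
          gcongr
          exact le_abs_self _
      _ ≤ 1 := hβa
      _ ≤ reg.a k * reg.L k := hL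
  nlinarith

/-! ### The block side `n(β) = ⌊√(25β/2)⌋` -/

/-- `n(β)² ≤ 25β/2`. -/
theorem deep_blockSide_sq_le {β : ℝ} (hβ : 0 ≤ β) :
    ((⌊Real.sqrt (25 / 2 * β)⌋₊ : ℕ) : ℝ) ^ 2 ≤ 25 / 2 * β := by
  have h1 : ((⌊Real.sqrt (25 / 2 * β)⌋₊ : ℕ) : ℝ) ≤ Real.sqrt (25 / 2 * β) :=
    Nat.floor_le (Real.sqrt_nonneg _)
  have h2 : (0 : ℝ) ≤ (⌊Real.sqrt (25 / 2 * β)⌋₊ : ℕ) := Nat.cast_nonneg _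
  calc _ ≤ Real.sqrt (25 / 2 * β) ^ 2 := pow_le_pow_left₀ h2 h1 2
    _ = 25 / 2 * β := Real.sq_sqrt (by positivity)

/-- `n(β) ≤ 25β/2` once `β ≥ 1`. -/
theorem deep_blockSide_le {β : ℝ} (hβ : 1 ≤ β) :
    ((⌊Real.sqrt (25 / 2 * β)⌋₊ : ℕ) : ℝ) ≤ 25 / 2 * β := by
  have h1 : ((⌊Real.sqrt (25 / 2 * β)⌋₊ : ℕ) : ℝ) ≤ Real.sqrt (25 / 2 * β) :=
    Nat.floor_le (Real.sqrt_nonneg _)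
  refine h1.trans ?_
  rw [Real.sqrt_le_left (by positivity)]
  nlinarith

/-- `3β ≤ n(β)²` once `β ≥ 1`. -/
theorem deep_three_mul_le_blockSide_sq {β : ℝ} (hβ : 1 ≤ β) :
    3 * β ≤ ((⌊Real.sqrt (25 / 2 * β)⌋₊ : ℕ) : ℝ) ^ 2 := by
  set s := Real.sqrt (25 / 2 * β) with hs_def
  have hs2 : s ^ 2 = 25 / 2 * β := Real.sq_sqrt (by positivity)
  have hs : (7 : ℝ) / 2 ≤ s := by
    rw [hs_def]
    exact Real.le_sqrt_of_sq_le (by nlinarith)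
  have hn : s - 1 ≤ ((⌊s⌋₊ : ℕ) : ℝ) := by linarith [Nat.lt_floor_add_one s]
  have h0 : 0 ≤ s - 1 := by linarith
  calc 3 * β ≤ (s - 1) ^ 2 := by nlinarith [sq_nonneg (s - 7 / 2)]
    _ ≤ ((⌊s⌋₊ : ℕ) : ℝ) ^ 2 := pow_le_pow_left₀ h0 hn 2

/-- `c ≤ n(β)` once `(c+1)² ≤ 25β/2`. -/
theorem deep_le_blockSide {β : ℝ} (c : ℕ) (h : ((c : ℝ) + 1) ^ 2 ≤ 25 / 2 * β) :
    c ≤ ⌊Real.sqrt (25 / 2 * β)⌋₊ := by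
  refine Nat.le_floor (Real.le_sqrt_of_sq_le ?_)
  nlinarith [(Nat.cast_nonneg c : (0 : ℝ) ≤ c)]

/-! ### The entropy bound for flat subsets of a block -/

/-- `(n+1)⁴ ≤ 2 n⁴` for `n ≥ 6`. -/
theorem deep_succ_pow_four_le_two_mul (n : ℕ) (hn : 6 ≤ n) : ((n : ℝ) + 1) ^ 4 ≤ 2 * (n : ℝ) ^ 4 := by
  obtain ⟨m, rfl⟩ := Nat.exists_eq_add_of_le hn
  have hm : (0 : ℝ) ≤ m := Nat.cast_nonneg m
  push_cast
  nlinarith [pow_nonneg hm 2, pow_nonneg hm 3, pow_nonneg hm 4]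

/-- `256^r ≤ e^{111 r/20}` (`8 log 2 < 5.55`). -/
theorem deep_pow_256_le_exp (r : ℕ) : (256 : ℝ) ^ r ≤ Real.exp (111 / 20 * r) := by
  have h2 : Real.log 256 ≤ 111 / 20 := by
    have : (256 : ℝ) = 2 ^ 8 := by norm_num
    rw [this, Real.log_pow]
    have := Real.log_two_lt_d9
    push_cast
    linarith
  calc (256 : ℝ) ^ r = Real.exp (Real.log 256) ^ r := by rw [Real.exp_log (by norm_num)]
    _ = Real.exp (r * Real.log 256) := by rw [← Real.exp_nat_mul]
    _ ≤ Real.exp (111 / 20 * r) :=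
        Real.exp_le_exp.2 (by nlinarith [h2, (Nat.cast_nonneg r : (0 : ℝ) ≤ r)])

/-- **Entropy bound.**  For `n ≥ 100`, with `r = ⌈n⁴/128⌉`:
`24 (n+1)⁴ · C((n+1)⁴, r) · e^{−7r} ≤ e^{−n⁴/1024}`.  Proof: `C(N,r) ≤ N^r/r! ≤ (256 r)^r/r! ≤ (256e)^r`
(`N = (n+1)⁴ ≤ 2n⁴ ≤ 256 r`, `r^r/r! ≤ e^r`), `256 ≤ e^{5.55}`, so `C(N,r) e^{−7r} ≤ e^{−0.45 r} ≤ e^{−0.45 n⁴/128}`,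
and the prefactor `48 n⁴` is absorbed by `e^{(0.45/128 − 1/1024) n⁴}`. -/
theorem deep_entropy_bound : ∀ (n : ℕ), 100 ≤ n →
    24 * ((n : ℝ) + 1) ^ 4 * (((n + 1) ^ 4).choose ⌈(n : ℝ) ^ 4 / 128⌉₊ : ℝ) *
        Real.exp (-7 * ⌈(n : ℝ) ^ 4 / 128⌉₊) ≤ Real.exp (-(n : ℝ) ^ 4 / 1024) := by
  intro n hn
  set y : ℝ := (n : ℝ) ^ 4 with hy
  set r : ℕ := ⌈y / 128⌉₊ with hr
  have hn' : (100 : ℝ) ≤ n := by exact_mod_cast hn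
  have hy0 : 0 ≤ y := by positivity
  have hybig : (100 : ℝ) ^ 4 ≤ y := pow_le_pow_left₀ (by norm_num) hn' 4
  have hr1 : y / 128 ≤ r := Nat.le_ceil _
  have hr0 : (0 : ℝ) ≤ r := Nat.cast_nonneg _
  have hM : ((n : ℝ) + 1) ^ 4 ≤ 2 * y := deep_succ_pow_four_le_two_mul n (by omega)
  have hMr : (((n + 1) ^ 4 : ℕ) : ℝ) ≤ 256 * r := by push_cast; linarith
  -- binomial `≤ (256 r)^r / r! ≤ 256^r e^r`
  have hchoose : (((n + 1) ^ 4).choose r : ℝ) ≤ (256 : ℝ) ^ r * Real.exp r := by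
    calc (((n + 1) ^ 4).choose r : ℝ) ≤ (((n + 1) ^ 4 : ℕ) : ℝ) ^ r / (r.factorial : ℝ) := by
            have := Nat.choose_le_pow_div (α := ℝ) r ((n + 1) ^ 4)
            push_cast at this ⊢
            exact this
      _ ≤ (256 * (r : ℝ)) ^ r / (r.factorial : ℝ) := by
            gcongr
      _ = (256 : ℝ) ^ r * ((r : ℝ) ^ r / (r.factorial : ℝ)) := by rw [mul_pow]; ring
      _ ≤ (256 : ℝ) ^ r * Real.exp r := by
            gcongr
            exact Real.pow_div_factorial_le_exp (r : ℝ) hr0 r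
  -- the prefactor
  have hpre : 24 * ((n : ℝ) + 1) ^ 4 ≤ 48 * y := by linarith
  have hexp : 48 * y ≤ Real.exp (13 / 5120 * y) := by
    have hq := Real.quadratic_le_exp_of_nonneg (show (0 : ℝ) ≤ 13 / 5120 * y by positivity)
    nlinarith [hq, mul_nonneg hy0 (sub_nonneg.2 hybig)]
  -- assemble
  have hA : 24 * ((n : ℝ) + 1) ^ 4 * (((n + 1) ^ 4).choose r : ℝ) * Real.exp (-7 * r) ≤
      Real.exp (13 / 5120 * y) * (Real.exp (111 / 20 * r) * Real.exp r) * Real.exp (-7 * r) := by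
    have h1 : 24 * ((n : ℝ) + 1) ^ 4 ≤ Real.exp (13 / 5120 * y) := hpre.trans hexp
    have h2 : (((n + 1) ^ 4).choose r : ℝ) ≤ Real.exp (111 / 20 * r) * Real.exp r :=
      hchoose.trans (mul_le_mul_of_nonneg_right (deep_pow_256_le_exp r) (Real.exp_pos _).le)
    have h24 : (0 : ℝ) ≤ 24 * ((n : ℝ) + 1) ^ 4 := by positivity
    gcongr
  refine hA.trans ?_
  rw [← Real.exp_add, ← Real.exp_add, ← Real.exp_add, Real.exp_le_exp]
  linarith

end Summit.QuantumFields.QCD.Cruxes.WindowExtinction.ChessboardColdCells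

end
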